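import Summits.Ventures.PercRepro.MSTightConjTCompletion
import Summits.Ventures.PercRepro.MSTightLost
import Summits.Ventures.PercRepro.MSTightKiller

/-!
# The lost differences of the completion `F̂ = P ∪ (F₁ + r)` — Theorem 1 of Addendum 48 §6

Dossier proofs/MINE1-theoremS.md, Addendum 48 §6 (Theorem 1). Fix `r` and `F`, write `P = proj r F`
(the trace), `F₀ = part0 r F`, `F₁ = partr r F`, `P₁ = F₁ \ F₀` (the partnerless `r`-members, as
`r`-free sets) and `T = completion1 r F = P ∪ (F₁ + r)` (the completion on the `r`-side of
MSTightConjTCompletion.lean). Then `F = T \ P₁` (`completion1_sdiff_partnerless`), so the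
lost-difference calculus of MSTightLost.lean applies with `M = P₁`:
* the `r`-free part of `T` is `P` and its `r`-part is `F₁` (`part0_completion1`, `partr_completion1`);
* an `r`-difference `w ∪ {r}` of `T` is lost iff every member of the trace disjoint from `w` is
  partnerless (`insert_mem_lost_completion1_iff`: the `⟸` direction is the definition, the `⟹`
  direction is the realisation from below in the tight twin-free `T`, `exists_sdiff_eq_of_disjoint`);
* no `r`-free difference of `T` is lost when `T` and the trace are tight
  (`notMem_lost_completion1_of_notMem`: Conjecture (T) from a tight completion, p457834, makes
  every `r`-free difference of `T` a difference of `F`);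
hence `lost T P₁ = {w ∪ {r} : w ∈ diffsY r T, every trace member disjoint from w is partnerless}`
(`lost_completion1_eq`) and, for tight `T`, the excess of `F` is `|P₁|` minus this count
(`card_diffs_eq_of_tight_completion1`): `F` has excess one iff exactly `|P₁| − 1` differences are
killed from below inside `diffsY r T` (`excess_one_iff_of_tight_completion1`). This is the exact form
in which the open shape of Conjecture (T) is analysed in Addendum 48 §6 (cases A / B / C).
-/

namespace PercRepro.MSTight

open Finset
open scoped FinsetFamily

variable {α : Type*} [DecidableEq α] [Fintype α] {r : α} {F : Finset (Finset α)}

section Parts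

omit [Fintype α] in
/-- The `r`-free members of `completion1 r F` are exactly the members of the trace. -/
theorem part0_completion1 : part0 r (completion1 r F) = proj r F := by
  apply Subset.antisymm
  · intro A hA
    obtain ⟨hAT, hrA⟩ := mem_part0.1 hA
    rcases mem_union.1 hAT with h | h
    · exact h
    · obtain ⟨B, -, rfl⟩ := mem_image.1 h
      exact absurd (mem_insert_self r B) hrA
  · exact proj_subset_part0_completion1

omit [Fintype α] in
/-- The `r`-members of `completion1 r F` (with `r` removed) are exactly `F₁`. -/
theorem partr_completion1 : partr r (completion1 r F) = partr r F := by
  apply Subset.antisymm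
  · intro A hA
    obtain ⟨hrA, hAT⟩ := mem_partr.1 hA
    rcases mem_union.1 hAT with h | h
    · exact absurd (mem_insert_self r A) (notMem_of_mem_proj_completion h)
    · obtain ⟨B, hB, hBA⟩ := mem_image.1 h
      have hrB : r ∉ B := (mem_partr.1 hB).1
      have : B = A := by
        have h1 := congrArg (fun S => S.erase r) hBA
        simp only [erase_insert hrB, erase_insert hrA] at h1
        exact h1
      rw [← this]; exact hB
  · exact partr_subset_partr_completion1

omit [Fintype α] in
/-- `F = completion1 r F \ P₁`: removing the partnerless `r`-members (as `r`-free sets) from the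
completion gives back `F`. -/
theorem completion1_sdiff_partnerless :
    completion1 r F \ (partr r F \ part0 r F) = F := by
  ext A
  simp only [mem_sdiff, not_and, not_not]
  by_cases hrA : r ∈ A
  · have hAM : A ∉ partr r F := fun h => (mem_partr.1 h).1 hrA
    constructor
    · rintro ⟨hAT, -⟩
      rcases mem_union.1 hAT with h | h
      · exact absurd hrA (notMem_of_mem_proj_completion h)
      · obtain ⟨B, hB, rfl⟩ := mem_image.1 h
        exact (mem_partr.1 hB).2
    · intro hA
      refine ⟨mem_union_right _ ?_, fun h => absurd h hAM⟩
      refine mem_image.2 ⟨A.erase r, mem_partr.2 ⟨notMem_erase r A, ?_⟩, insert_erase hrA⟩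
      rw [insert_erase hrA]; exact hA
  · constructor
    · rintro ⟨hAT, h⟩
      have hAP : A ∈ proj r F := by rw [← part0_completion1]; exact mem_part0.2 ⟨hAT, hrA⟩
      rw [proj_eq_union] at hAP
      rcases mem_union.1 hAP with h0 | h1
      · exact (mem_part0.1 h0).1
      · exact (mem_part0.1 (h h1)).1
    · intro hA
      have h0 : A ∈ part0 r F := mem_part0.2 ⟨hA, hrA⟩
      exact ⟨mem_union_left _ (part0_subset_proj_completion h0), fun _ => h0⟩

end Parts

section Lost

omit [Fintype α] in
/-- An `r`-difference `w ∪ {r}` of `T = completion1 r F` is lost when `P₁` is removed as soon as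
every member of the trace disjoint from `w` is partnerless (the definition of `lost`). -/
theorem insert_mem_lost_completion1_of_forall {w : Finset α}
    (hw : insert r w ∈ completion1 r F \\ completion1 r F)
    (hM : ∀ b ∈ proj r F, Disjoint w b → b ∈ partr r F \ part0 r F) :
    insert r w ∈ lost (completion1 r F) (partr r F \ part0 r F) := by
  rw [mem_lost]
  refine ⟨hw, fun a ha b hb hab => Or.inr ?_⟩
  have hrb : r ∉ b := fun h => by
    have : r ∈ a \ b := by rw [hab]; exact mem_insert_self r w
    exact (mem_sdiff.1 this).2 h
  have hbP : b ∈ proj r F := by rw [← part0_completion1]; exact mem_part0.2 ⟨hb, hrb⟩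
  refine hM b hbP (disjoint_left.2 fun x hxw hxb => ?_)
  have : x ∈ a \ b := by rw [hab]; exact mem_insert_of_mem hxw
  exact (mem_sdiff.1 this).2 hxb

/-- **Theorem 1 (i) of Addendum 48.** For a tight twin-free completion `T = completion1 r F`, an
`r`-difference `w ∪ {r}` of `T` is lost when `P₁` is removed iff every member of the trace
disjoint from `w` is partnerless. -/
theorem insert_mem_lost_completion1_iff (hC : Tight (completion1 r F))
    (htf : ∀ a b, Twin (completion1 r F) a b → a = b) {w : Finset α}
    (hw : insert r w ∈ completion1 r F \\ completion1 r F) :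
    insert r w ∈ lost (completion1 r F) (partr r F \ part0 r F) ↔
      ∀ b ∈ proj r F, Disjoint w b → b ∈ partr r F \ part0 r F := by
  constructor
  · intro hl b hb hwb
    have hbT : b ∈ completion1 r F := mem_union_left _ hb
    have hrb : r ∉ b := notMem_of_mem_proj_completion hb
    have hdisj : Disjoint (insert r w) b := by
      rw [disjoint_insert_left]; exact ⟨hrb, hwb⟩
    obtain ⟨a, ha, hab⟩ := exists_sdiff_eq_of_disjoint hC htf hw hbT hdisj
    rcases ((mem_lost.1 hl).2 a ha b hbT hab) with h | h
    · exfalso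
      have hra : r ∈ a := by
        have : r ∈ a \ b := by rw [hab]; exact mem_insert_self r w
        exact (mem_sdiff.1 this).1
      exact (mem_partr.1 (mem_sdiff.1 h).1).1 hra
    · exact h
  · exact insert_mem_lost_completion1_of_forall hw

omit [Fintype α] in
/-- **Theorem 1 (ii) of Addendum 48.** With a tight trace and a tight completion, no `r`-free
difference of `completion1 r F` is lost when `P₁` is removed (Conjecture (T) from a tight
completion, p457834). -/
theorem notMem_lost_completion1_of_notMem (hP : Tight (proj r F)) (hC : Tight (completion1 r F))
    {w : Finset α} (hrw : r ∉ w) : w ∉ lost (completion1 r F) (partr r F \ part0 r F) := by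
  intro hl
  have hwT : w ∈ completion1 r F \\ completion1 r F := (mem_lost.1 hl).1
  -- `w` is an `r`-free difference of `T`, hence a difference of the trace `P`, hence (by (T)
  -- at `r`) an `r`-free difference of `F = T \ P₁` — which is not lost.
  have hwP : w ∈ proj r F \\ proj r F := by
    have h1 : w ∈ (completion1 r F \\ completion1 r F).filter (fun E => r ∉ E) :=
      mem_filter.2 ⟨hwT, hrw⟩
    rw [diffs_filter_notMem, diffsX, part0_completion1, partr_completion1] at h1
    rcases mem_union.1 h1 with h | h
    · rcases mem_union.1 h with h' | h'
      · exact h'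
      · exact diffs_subset partr_subset_proj_completion partr_subset_proj_completion h'
    · exact diffs_subset_left partr_subset_proj_completion h
  have hwX : w ∈ diffsX r F := by
    rw [diffs_proj_eq] at hwP
    rcases mem_union.1 hwP with h | h
    · exact h
    · exact diffsY_subset_diffsX_of_tight_completion1 hP hC h
  have hwF : w ∈ F \\ F := by
    rw [← diffs_filter_notMem] at hwX
    exact (mem_filter.1 hwX).1
  rw [← completion1_sdiff_partnerless (r := r) (F := F), diffs_sdiff_eq_diffs_sdiff_lost] at hwF
  exact (mem_sdiff.1 hwF).2 hl

/-- **Theorem 1 of Addendum 48.** For a tight trace and a tight twin-free completion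
`T = completion1 r F`, the lost differences of `T` (when the partnerless `r`-members are removed)
are exactly the sets `w ∪ {r}` with `w ∈ diffsY r T` such that every member of the trace disjoint
from `w` is partnerless. -/
theorem lost_completion1_eq (hP : Tight (proj r F)) (hC : Tight (completion1 r F))
    (htf : ∀ a b, Twin (completion1 r F) a b → a = b) :
    lost (completion1 r F) (partr r F \ part0 r F) =
      ((diffsY r (completion1 r F)).filter
        (fun w => ∀ b ∈ proj r F, Disjoint w b → b ∈ partr r F \ part0 r F)).image (insert r) := by
  ext E
  constructor
  · intro hE
    have hrE : r ∈ E := by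
      by_contra hrE
      exact notMem_lost_completion1_of_notMem hP hC hrE hE
    have hET : E ∈ completion1 r F \\ completion1 r F := (mem_lost.1 hE).1
    have h1 : E ∈ (completion1 r F \\ completion1 r F).filter (fun E => r ∈ E) :=
      mem_filter.2 ⟨hET, hrE⟩
    rw [diffs_filter_mem] at h1
    obtain ⟨w, hwY, rfl⟩ := mem_image.1 h1
    have hrw : r ∉ w := notMem_of_mem_diffsY hwY
    refine mem_image.2 ⟨w, mem_filter.2 ⟨hwY, ?_⟩, rfl⟩
    exact (insert_mem_lost_completion1_iff hC htf hET).1 hE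
  · intro hE
    obtain ⟨w, hw, rfl⟩ := mem_image.1 hE
    obtain ⟨hwY, hM⟩ := mem_filter.1 hw
    have hrw : r ∉ w := notMem_of_mem_diffsY hwY
    have hwT : insert r w ∈ completion1 r F \\ completion1 r F := by
      have : insert r w ∈ (completion1 r F \\ completion1 r F).filter (fun E => r ∈ E) := by
        rw [diffs_filter_mem]; exact mem_image_of_mem _ hwY
      exact (mem_filter.1 this).1
    exact insert_mem_lost_completion1_of_forall hwT hM

/-- The number of lost differences equals the number of `w ∈ diffsY r T` killed from below by
`P₁` inside the trace. -/
theorem card_lost_completion1 (hP : Tight (proj r F)) (hC : Tight (completion1 r F))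
    (htf : ∀ a b, Twin (completion1 r F) a b → a = b) :
    (lost (completion1 r F) (partr r F \ part0 r F)).card =
      ((diffsY r (completion1 r F)).filter
        (fun w => ∀ b ∈ proj r F, Disjoint w b → b ∈ partr r F \ part0 r F)).card := by
  rw [lost_completion1_eq hP hC htf]
  apply card_image_of_injOn
  intro w hw w' hw' hww'
  have hrw : r ∉ w := notMem_of_mem_diffsY (mem_filter.1 hw).1
  have hrw' : r ∉ w' := notMem_of_mem_diffsY (mem_filter.1 hw').1
  have h := congrArg (fun S => S.erase r) hww'
  simp only [erase_insert hrw, erase_insert hrw'] at h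
  exact h

/-- **The excess of `F` in the F̂-tight normal form:** `|D(F)| = |F| + (|P₁| − #killed)` where
`#killed` counts the `w ∈ diffsY r T` killed from below by `P₁` inside the trace. -/
theorem card_diffs_eq_of_tight_completion1 (hP : Tight (proj r F))
    (hC : Tight (completion1 r F)) (htf : ∀ a b, Twin (completion1 r F) a b → a = b) :
    (F \\ F).card = F.card + ((partr r F \ part0 r F).card -
      ((diffsY r (completion1 r F)).filter
        (fun w => ∀ b ∈ proj r F, Disjoint w b → b ∈ partr r F \ part0 r F)).card) := by
  have hM : partr r F \ part0 r F ⊆ completion1 r F :=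
    sdiff_subset.trans (partr_subset_proj_completion.trans proj_subset_part0_completion1
      |>.trans (filter_subset _ _))
  have h := card_diffs_sdiff_eq_of_tight hC hM
  rw [completion1_sdiff_partnerless, card_lost_completion1 hP hC htf] at h
  exact h

/-- **Excess one in the F̂-tight normal form** ⟺ exactly `|P₁| − 1` of the `w ∈ diffsY r T` are
killed from below by `P₁` inside the trace (Addendum 48 §6, the starting point of cases A/B/C). -/
theorem excess_one_iff_of_tight_completion1 (hP : Tight (proj r F))
    (hC : Tight (completion1 r F)) (htf : ∀ a b, Twin (completion1 r F) a b → a = b) :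
    (F \\ F).card = F.card + 1 ↔
      ((diffsY r (completion1 r F)).filter
        (fun w => ∀ b ∈ proj r F, Disjoint w b → b ∈ partr r F \ part0 r F)).card + 1 =
        (partr r F \ part0 r F).card := by
  have hM : partr r F \ part0 r F ⊆ completion1 r F :=
    sdiff_subset.trans (partr_subset_proj_completion.trans proj_subset_part0_completion1
      |>.trans (filter_subset _ _))
  have h := card_diffs_sdiff_eq_succ_iff_of_tight hC hM
  rw [completion1_sdiff_partnerless, card_lost_completion1 hP hC htf] at h
  exact h

end Lost

end PercRepro.MSTight
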